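import Mathlib
import Summits.ResolutionOfSingularities.ResolutionOfSingularities.Theses.HilbertSamuelElimination

/-!
# Sketch — crux ideas for `SigmaMaxModifications` (stmt-ResolutionOfSingularities-18506), ideator k = 1

First lemmas of the idea cards, stated over existing declarations (Mathlib + the route file's
fact-free imports). Everything here is a `def … : Prop` (statements only; nothing is claimed proved).
`H` is inlined exactly as in the crux.
-/

open AlgebraicGeometry CategoryTheory TopologicalSpace Topology

namespace Summit.ResolutionOfSingularities.ResolutionOfSingularities.Theses.HilbertSamuelElimination

/-- The crux's inline Hilbert–Samuel function `H^N_Y(y) = H^{(N - ψ(𝒪_{Y,y}))}(𝒪_{Y,y})`. -/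
noncomputable def hsH (N : ℕ) (Y : Scheme.{0}) (y : Y) : ℕ → ℕ :=
  Literature.RingTheory.HilbertSamuel.hilbertSamuelFun (Y.presheaf.stalk y)
    (N - Literature.RingTheory.HilbertSamuel.minimalPrimesCodim (Y.presheaf.stalk y))

/-- The crux's inline Hilbert–Samuel locus `Y_max` at level `N`. -/
def hsMax (N : ℕ) (Y : Scheme.{0}) : Set Y :=
  {y | Maximal (· ∈ Set.range (hsH N Y)) (hsH N Y y)}

/-- (USC) CJS Thm 2.33 (1) in the crux's setting, at EVERY level `N ≥ dim X` (the tree proves it for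
`N > dim X`; `N = dim X` needs Singh's `H^{(0)}` inequality): along a specialization `y ⤳ x` the
function does not decrease. Support statement of the line. -/
def HSUpperSemicontinuous : Prop :=
  ∀ p : ℕ, p.Prime → ∀ (k : Type) [Field k] [CharP k p] (X : Scheme.{0})
    (f : X ⟶ Spec (.of k)), IsSeparated f → LocallyOfFiniteType f → QuasiCompact f → IsReduced X →
    ∀ N : ℕ, topologicalKrullDim X ≤ (N : WithBot ℕ∞) →
      ∀ x y : X, y ⤳ x → hsH N X y ≤ hsH N X x

/-- **Targeted filling (TF)** — the flexible induction hypothesis: for a CLOSED `Z ⊆ X` and a target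
`ν` (constant along specializations inside `Z`) such that every value of `H` at a point outside `Z`
specializing into `Z` is `< ν` there, there is a proper `π : X' → X`, `X'` reduced of dimension `≤ N`,
an isomorphism over every open inside `X ∖ Z` with dense preimage of `X ∖ Z`, after which `H < ν` at
every point over `Z`. (The crux is the instance `Z = X_max`, `ν = H_X`.) -/
def TargetedFilling : Prop :=
  ∀ p : ℕ, p.Prime → ∀ (k : Type) [Field k] [CharP k p] (X : Scheme.{0})
    (f : X ⟶ Spec (.of k)), IsSeparated f → LocallyOfFiniteType f → QuasiCompact f → IsReduced X →
    ∀ N : ℕ, topologicalKrullDim X ≤ (N : WithBot ℕ∞) →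
    ∀ Z : Set X, IsClosed Z → ∀ ν : X → (ℕ → ℕ),
      (∀ z ∈ Z, ∀ z' ∈ Z, z' ⤳ z → ν z' = ν z) →
      (∀ z ∈ Z, ∀ y ∉ Z, y ⤳ z → hsH N X y < ν z) →
      ∃ (X' : Scheme.{0}) (π : X' ⟶ X), IsProper π ∧ IsReduced X' ∧
        topologicalKrullDim X' ≤ (N : WithBot ℕ∞) ∧
        (∀ U : X.Opens, (U : Set X) ⊆ Zᶜ → IsIso (π ∣_ U)) ∧
        Dense ((fun x' => π.base x') ⁻¹' Zᶜ) ∧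
        ∀ x' : X', π.base x' ∈ Z → hsH N X' x' < ν (π.base x')

/-- **Pointed crux (the transfer target C⁺)**: `SigmaMaxModifications` restricted to schemes whose
Hilbert–Samuel locus `X_max` is PROPER over `k` (with its reduced structure) — e.g. finitely many
closed points, or complete exceptional subvarieties lying over finitely many closed points of some
other finite-type `k`-scheme dominated by `X`. -/
def PointedSigmaMaxModifications : Prop :=
  ∀ p : ℕ, p.Prime → ∀ (k : Type) [Field k] [CharP k p] (X : Scheme.{0})
    (f : X ⟶ Spec (.of k)), IsSeparated f → LocallyOfFiniteType f → QuasiCompact f → IsReduced X →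
    ¬ Literature.AlgebraicGeometry.Resolution.Scheme.IsRegular X →
    ∀ N : ℕ, topologicalKrullDim X ≤ (N : WithBot ℕ∞) →
    ∀ hc : IsClosed (hsMax N X),
      IsProper ((Scheme.IdealSheafData.vanishingIdeal (⟨hsMax N X, hc⟩ : Closeds X)).subschemeι ≫ f) →
      ∃ (X' : Scheme.{0}) (π : X' ⟶ X), IsProper π ∧ IsReduced X' ∧
        topologicalKrullDim X' ≤ (N : WithBot ℕ∞) ∧
        (∀ U : X.Opens, (U : Set X) ⊆ (hsMax N X)ᶜ → IsIso (π ∣_ U)) ∧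
        Dense ((fun x' => π.base x') ⁻¹' (hsMax N X)ᶜ) ∧
        (∀ x' : X', hsH N X' x' ≤ hsH N X (π.base x')) ∧
        ∀ ν : ℕ → ℕ, Maximal (· ∈ Set.range (hsH N X)) ν → ν ∉ Set.range (hsH N X')

/-! ### First lemmas (card `pointed-reduction-generic-fibres`) -/

/-- First lemma (a): TF implies the crux, given upper semicontinuity (take `Z = X_max`, `ν = H_X`;
maximality + (USC) give the specialization condition, strict drop over `X_max` gives monotonicity and
(ME2) because a maximal `ν' ≤ ν` maximal forces `ν' = ν`). Pure logic + (USC). -/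
def FirstLemmaTFImpliesCrux : Prop :=
  TargetedFilling → HSUpperSemicontinuous → SigmaMaxModifications

/-- First lemma (b): the GARBAGE LOCUS IS CLOSED — for `π : X' → X`, a closed `Z ⊆ X`, a constant
target `ν`, finitely many values of `H` on `X'` and closed super-level sets `{H ≥ μ}` (CJS Thm 2.33 (3)),
the set of points over `Z` at which `H` has NOT dropped below `ν` is closed
(`= π⁻¹ Z ∩ ⋃_{μ ≮ ν} {H ≥ μ}`, a finite union). This is what lets the damage of a spread-out witness be
handed to the next step of the noetherian induction. -/
def FirstLemmaBadLocusClosed : Prop :=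
  ∀ (X' X : Scheme.{0}) (π : X' ⟶ X) (N : ℕ) (Z : Set X), IsClosed Z →
    (∀ μ : ℕ → ℕ, IsClosed {x' : X' | μ ≤ hsH N X' x'}) → (Set.range (hsH N X')).Finite →
    ∀ ν : ℕ → ℕ, IsClosed {x' : X' | π.base x' ∈ Z ∧ ¬ hsH N X' x' < ν}

/-- First lemma (c): GENERIC-FIBRE IDENTITY — a morphism inducing an isomorphism on the stalk at `y`
(e.g. the inclusion of the generic fibre `X ×_{𝔸ᵗ_k} Spec k(t₁,…,t_t) → X` at any of its points)
preserves the crux's `H` at the SAME level `N` (both `hilbertSamuelFun` and `minimalPrimesCodim` are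
ring-isomorphism invariants). -/
def FirstLemmaGenericFibreIdentity : Prop :=
  ∀ (Y X : Scheme.{0}) (g : Y ⟶ X) (y : Y), IsIso (g.stalkMap y) → ∀ N : ℕ, hsH N Y y = hsH N X (g.base y)

/-- First lemma (d): TARGETING BY OPEN RESTRICTION — "maximal among the values `≮ ν` is maximal":
if `μ ≮ ν` and `μ ≤ μ'` then `μ' ≮ ν` (pure order theory on `ℕ → ℕ`); hence on the open
`X°° = X ∖ (closure{y ∉ Z : H y ≮ ν} ∪ ⋃_{μ max, μ < ν} closure{H = μ})` the Hilbert–Samuel locus consists of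
bad points of `Z` only, so the crux applied to `X°°` kills exactly the top bad values. -/
def FirstLemmaTargeting : Prop :=
  ∀ (S : Set (ℕ → ℕ)) (ν μ : ℕ → ℕ), μ ∈ S → ¬ μ < ν →
    Maximal (· ∈ {l | l ∈ S ∧ ¬ l < ν}) μ → Maximal (· ∈ S) μ

/-- **The line's main theorem (transfer)**: the pointed crux implies the crux (Temkin-style
noetherian induction on the image of the bad locus, generic fibres over `k(t)` for the horizontal part,
`j_*`-extension of the spread-out blow-up ideal, CJS Thm 6.17 iteration for value targeting). -/
def PointedReduction : Prop :=
  PointedSigmaMaxModifications → HSUpperSemicontinuous → SigmaMaxModifications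

/-- Sanity: the crux trivially implies its pointed case. -/
theorem pointed_of_crux (h : SigmaMaxModifications) : PointedSigmaMaxModifications := by
  intro p hp k _ _ X f hsep hft hqc hred hreg N hdim _ _
  exact h p hp k X f hsep hft hqc hred hreg N hdim

end Summit.ResolutionOfSingularities.ResolutionOfSingularities.Theses.HilbertSamuelElimination
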